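import Literature.NumberTheory.Automorphic.UnitaryGroupDualPairCarriers
import Literature.RepresentationTheory.HeisenbergGroup.SymplecticMatrixTransport
import HarnessLib

/-!
# Rational points of `U(V)` land in the rational points of `Sp(Res V)`: the junction `toSp(G(F)) ⊆ Sp_F(W)`

Topic `NumberTheory/Automorphic`; namespace `Literature.NumberTheory.Automorphic.UnitaryGroup` (fourth part of
`UnitaryGroupSymplecticEmbedding`). Definitions and proved lemmas only: **no named facts, 0 proof holes**.

Two descriptions of "the symplectic group of `W`" coexist in the tree: weil-1's coordinate-free
`symplecticGroup (polar β_T) ≤ GL(W)`, `W = K^ι × K^ι`, `β_T(x, y) = x ⬝ᵥ T y` (the group the Heisenberg group, the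
Schrödinger model and our embeddings `U(V) ↪ Sp(Res V)` live on), and Mathlib's matrix group `Matrix.symplecticGroup ι K`
(`A J Aᵀ = J`), on which change of scalars `F → 𝔸_F` is entrywise. `SymplecticMatrixTransport` gives the transport
`transportSp T hT : Matrix.symplecticGroup ι K →* symplecticGroup (polar β_T)` (`A ↦ P⁻¹ A P`, `P (x, y) = (x, T y)`,
`T.det` a unit) and change of scalars `mapHom f`; the **rational points of `Sp_𝔸(W)`** of record are the range of
`(transportSp (T.map ι) _).comp (mapHom ι)`, `ι = algebraMap F 𝔸_F`.

This file proves that the adelic embedding of `UnitaryGroupSymplecticCarriers` carries RATIONAL points of the unitary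
group into that range — Gelbart–Rogawski's "`s(G(F)) ⊂ i(Sp_F(W))`" [GelbartRogawski1991, §3.1 p. 455], the field
`toSp_mem_spRat` of a splitting datum — for `U(J)`, `J = T ⊗ 1`, and for the big group `G₁ = U(J_V ⊗ J_W)` of the dual
pair:

* §1 (any commutative ring): the INVERSE transport `untransportSp T hT : symplecticGroup (polar β_T) →* Sp_{2ι}(K)`
  (`g ↦` the matrix of `P g P⁻¹`), `transportSp ∘ untransportSp = id = untransportSp ∘ transportSp`, packaged as
  **`transportSpEquiv : Matrix.symplecticGroup ι K ≃* symplecticGroup (polar β_T)`** (so `transportSp` is onto: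
  `range_transportSp_eq_top`).
* §2 (change of scalars `f : K →+* K'`, `T' = T.map f`): if `g' ∈ Sp(W', β_{T'})` EXTENDS `g ∈ Sp(W, β_T)` on
  `K`-rational vectors (`g' (f ∘ v) = f ∘ (g v)`), then **`g' = transportSp T' (mapHom f (untransportSp T g))`**
  (`eq_transportSp_mapHom_untransportSp`), hence `g' ∈ ((transportSp T' hT').comp (mapHom f)).range`.
* §3 (number fields): `adelicToSymplectic (toAdelic γ)` extends `rationalToSymplectic γ` on `F`-rational vectors
  (`adelicToSymplectic_toAdelic_apply_algebraMap`, from the two block formulas), so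
  **`adelicToSymplectic_toAdelic_mem_range`**: `ι_𝔸(γ) ∈ ((transportSp (T.map ι) hT').comp (mapHom ι)).range` for every
  `γ ∈ U(J)(F)` (`T.det ≠ 0`), i.e. `(ι_𝔸 ∘ toAdelic).range ≤ Sp_F(W)`.
* §4: the same for the dual pair, `rationalPairToSymplectic : G₁(F) →* Sp_F(𝕎)`, `𝕎 = Res(V ⊗ W)`, Gram matrix
  `T_V ⊗ₖ T_W`, and **`adelicPairToSymplectic_rationalPairToAdelic_mem_range`**.

Combined with `SymplecticMatrix.range_transportSp_mapHom_le` (the range is contained in any subgroup containing weil-1's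
Levi / unipotent / Weyl elements at rational parameters) this is how "`toSp(G(F))` is Θ-liftable" is assembled downstream;
nothing about theta series is used or asserted here. Pure linear algebra, kernel only.
-/

noncomputable section

open Matrix NumberField IsDedekindDomain
open scoped Kronecker
open Literature.RepresentationTheory.HeisenbergGroup

namespace Literature.NumberTheory.Automorphic

namespace UnitaryGroup

/-! ## 1. The inverse transport and `transportSpEquiv` -/

namespace SpTransport

section Generic

variable {K : Type*} [CommRing K] {ι : Type*} [Fintype ι] [DecidableEq ι] (T : Matrix ι ι K) (hT : IsUnit T.det)

/-- The matrix of `P ∘ g ∘ P⁻¹` in the standard basis of `K^{ι ⊕ ι}`, `P = darboux T` (`(x, y) ↦ (x, T y)`).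
[folklore] -/
def untransportMatrix (g : ((ι → K) × (ι → K)) ≃ₗ[K] ((ι → K) × (ι → K))) : Matrix (ι ⊕ ι) (ι ⊕ ι) K :=
  LinearMap.toMatrix'
    ((((SymplecticMatrix.darboux T hT).symm.trans (g.trans (SymplecticMatrix.darboux T hT)) :
        (ι ⊕ ι → K) ≃ₗ[K] (ι ⊕ ι → K)) : (ι ⊕ ι → K) →ₗ[K] (ι ⊕ ι → K)))

/-- `untransportMatrix T g u = P (g (P⁻¹ u))`. [folklore] -/
theorem untransportMatrix_mulVec (g : ((ι → K) × (ι → K)) ≃ₗ[K] ((ι → K) × (ι → K))) (u : ι ⊕ ι → K) :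
    untransportMatrix T hT g *ᵥ u =
      SymplecticMatrix.darboux T hT (g ((SymplecticMatrix.darboux T hT).symm u)) := by
  rw [untransportMatrix, ← Matrix.toLin'_apply, Matrix.toLin'_toMatrix']
  rfl

/-- The entries: `untransportMatrix T g i j = (P (g (P⁻¹ e_j))) i`. [folklore] -/
theorem untransportMatrix_apply (g : ((ι → K) × (ι → K)) ≃ₗ[K] ((ι → K) × (ι → K))) (i j : ι ⊕ ι) :
    untransportMatrix T hT g i j =
      SymplecticMatrix.darboux T hT (g ((SymplecticMatrix.darboux T hT).symm (Pi.single j 1))) i := by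
  rw [← untransportMatrix_mulVec, Matrix.mulVec_single_one, Matrix.col_apply]

/-- For `g ∈ Sp(W, β_T)` the matrix `A = untransportMatrix T g` preserves the `J`-form:
`(A u) ⬝ᵥ J (A u') = u ⬝ᵥ J u'` (`alt (polar β_T)` is minus the `J`-form in Darboux coordinates). [folklore] -/
theorem jForm_untransportMatrix (g : symplecticGroup (polar (Matrix.toLinearMap₂' K T))) (u u' : ι ⊕ ι → K) :
    (untransportMatrix T hT (g : ((ι → K) × (ι → K)) ≃ₗ[K] ((ι → K) × (ι → K))) *ᵥ u) ⬝ᵥ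
        (Matrix.J ι K *ᵥ (untransportMatrix T hT (g : ((ι → K) × (ι → K)) ≃ₗ[K] ((ι → K) × (ι → K))) *ᵥ u')) =
      u ⬝ᵥ (Matrix.J ι K *ᵥ u') := by
  have hg : alt (polar (Matrix.toLinearMap₂' K T))
      ((g : ((ι → K) × (ι → K)) ≃ₗ[K] ((ι → K) × (ι → K))) ((SymplecticMatrix.darboux T hT).symm u))
      ((g : ((ι → K) × (ι → K)) ≃ₗ[K] ((ι → K) × (ι → K))) ((SymplecticMatrix.darboux T hT).symm u')) =
      alt (polar (Matrix.toLinearMap₂' K T)) ((SymplecticMatrix.darboux T hT).symm u)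
        ((SymplecticMatrix.darboux T hT).symm u') :=
    (mem_symplecticGroup (polar (Matrix.toLinearMap₂' K T)) _).1 g.2 _ _
  have h1 : ∀ w : ι ⊕ ι → K, Sum.elim ((SymplecticMatrix.darboux T hT).symm w).1
      (T *ᵥ ((SymplecticMatrix.darboux T hT).symm w).2) = w := fun w =>
    (SymplecticMatrix.darboux T hT).apply_symm_apply w
  rw [SymplecticMatrix.alt_polar_eq_neg_jForm, SymplecticMatrix.alt_polar_eq_neg_jForm, neg_inj, h1, h1] at hg
  rw [untransportMatrix_mulVec, untransportMatrix_mulVec, SymplecticMatrix.darboux_apply,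
    SymplecticMatrix.darboux_apply]
  exact hg

/-- `untransportMatrix T g ∈ Sp_{2ι}(K)` for `g ∈ Sp(W, β_T)` (`Aᵀ J A = J`). [folklore] -/
theorem untransportMatrix_mem (g : symplecticGroup (polar (Matrix.toLinearMap₂' K T))) :
    untransportMatrix T hT (g : ((ι → K) × (ι → K)) ≃ₗ[K] ((ι → K) × (ι → K))) ∈ Matrix.symplecticGroup ι K := by
  rw [SymplecticGroup.mem_iff']
  apply (Matrix.toLinearMap₂' K :
    Matrix (ι ⊕ ι) (ι ⊕ ι) K ≃ₗ[K] (ι ⊕ ι → K) →ₗ[K] (ι ⊕ ι → K) →ₗ[K] K).injective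
  refine LinearMap.ext fun u => LinearMap.ext fun u' => ?_
  rw [Matrix.toLinearMap₂'_apply', Matrix.toLinearMap₂'_apply', ← Matrix.mulVec_mulVec, ← Matrix.mulVec_mulVec,
    Matrix.dotProduct_mulVec, Matrix.vecMul_transpose]
  exact jForm_untransportMatrix T hT g u u'

/-- **The inverse transport `Sp(W, β_T) →* Sp_{2ι}(K)`**, `g ↦` the matrix of `P g P⁻¹`. [folklore] -/
def untransportSp : symplecticGroup (polar (Matrix.toLinearMap₂' K T)) →* Matrix.symplecticGroup ι K where
  toFun g := ⟨untransportMatrix T hT (g : ((ι → K) × (ι → K)) ≃ₗ[K] ((ι → K) × (ι → K))),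
    untransportMatrix_mem T hT g⟩
  map_one' := by
    apply Subtype.ext
    change untransportMatrix T hT ((1 : symplecticGroup (polar (Matrix.toLinearMap₂' K T))) :
      ((ι → K) × (ι → K)) ≃ₗ[K] ((ι → K) × (ι → K))) = 1
    apply Matrix.toLin'.injective
    refine LinearMap.ext fun u => ?_
    rw [Matrix.toLin'_apply, Matrix.toLin'_apply, untransportMatrix_mulVec, Matrix.one_mulVec, OneMemClass.coe_one]
    exact (SymplecticMatrix.darboux T hT).apply_symm_apply u
  map_mul' g g' := by
    apply Subtype.ext
    change untransportMatrix T hT ((g * g' : symplecticGroup (polar (Matrix.toLinearMap₂' K T))) :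
        ((ι → K) × (ι → K)) ≃ₗ[K] ((ι → K) × (ι → K))) =
      untransportMatrix T hT (g : ((ι → K) × (ι → K)) ≃ₗ[K] ((ι → K) × (ι → K))) *
        untransportMatrix T hT (g' : ((ι → K) × (ι → K)) ≃ₗ[K] ((ι → K) × (ι → K)))
    apply Matrix.toLin'.injective
    refine LinearMap.ext fun u => ?_
    rw [Matrix.toLin'_apply, Matrix.toLin'_apply, ← Matrix.mulVec_mulVec, untransportMatrix_mulVec,
      untransportMatrix_mulVec, untransportMatrix_mulVec, LinearEquiv.symm_apply_apply, Subgroup.coe_mul,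
      LinearEquiv.mul_apply]

/-- The matrix of `untransportSp T g`. [folklore] -/
@[simp] theorem coe_untransportSp (g : symplecticGroup (polar (Matrix.toLinearMap₂' K T))) :
    ((untransportSp T hT g : Matrix.symplecticGroup ι K) : Matrix (ι ⊕ ι) (ι ⊕ ι) K) =
      untransportMatrix T hT (g : ((ι → K) × (ι → K)) ≃ₗ[K] ((ι → K) × (ι → K))) :=
  rfl

/-- `transportSp (untransportSp g) = g`. [folklore] -/
theorem transportSp_untransportSp (g : symplecticGroup (polar (Matrix.toLinearMap₂' K T))) :
    SymplecticMatrix.transportSp T hT (untransportSp T hT g) = g := by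
  apply Subtype.ext
  refine LinearEquiv.ext fun v => ?_
  rw [SymplecticMatrix.coe_transportSp_apply, coe_untransportSp, untransportMatrix_mulVec,
    LinearEquiv.symm_apply_apply, LinearEquiv.symm_apply_apply]

/-- `untransportSp (transportSp A) = A`. [folklore] -/
theorem untransportSp_transportSp (A : Matrix.symplecticGroup ι K) :
    untransportSp T hT (SymplecticMatrix.transportSp T hT A) = A :=
  SymplecticMatrix.transportSp_injective T hT (transportSp_untransportSp T hT _)

/-- **`Sp_{2ι}(K) ≃* Sp(W, β_T)`**: the transport of `SymplecticMatrixTransport` is an isomorphism of groups, with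
inverse `untransportSp`. [folklore] -/
def transportSpEquiv : Matrix.symplecticGroup ι K ≃* symplecticGroup (polar (Matrix.toLinearMap₂' K T)) where
  toFun := SymplecticMatrix.transportSp T hT
  invFun := untransportSp T hT
  left_inv := untransportSp_transportSp T hT
  right_inv := transportSp_untransportSp T hT
  map_mul' := map_mul _

/-- `transportSpEquiv A = transportSp A`. [folklore] -/
@[simp] theorem transportSpEquiv_apply (A : Matrix.symplecticGroup ι K) :
    transportSpEquiv T hT A = SymplecticMatrix.transportSp T hT A := rfl

/-- `transportSpEquiv.symm g = untransportSp g`. [folklore] -/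
@[simp] theorem transportSpEquiv_symm_apply (g : symplecticGroup (polar (Matrix.toLinearMap₂' K T))) :
    (transportSpEquiv T hT).symm g = untransportSp T hT g := rfl

/-- The transport is onto: every element of `Sp(W, β_T)` is `P⁻¹ A P` for a symplectic matrix `A`. [folklore] -/
theorem range_transportSp_eq_top : (SymplecticMatrix.transportSp T hT).range = ⊤ :=
  MonoidHom.range_eq_top.mpr fun g => ⟨untransportSp T hT g, transportSp_untransportSp T hT g⟩

/-- `untransportSp` is injective. [folklore] -/
theorem untransportSp_injective : Function.Injective (untransportSp T hT) :=
  (transportSpEquiv T hT).symm.injective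

/-! ## 2. Change of scalars: an element extending a `K`-rational one is a rational point -/

variable {K' : Type*} [CommRing K'] (f : K →+* K') (T' : Matrix ι ι K') (hT' : IsUnit T'.det) (hTT' : T' = T.map f)
include hTT'

/-- Darboux coordinates commute with change of scalars: `P' (f ∘ x, f ∘ y) = f ∘ P (x, y)` for `T' = T.map f`.
[folklore] -/
theorem darboux_baseChange (v : (ι → K) × (ι → K)) :
    SymplecticMatrix.darboux T' hT' (⇑f ∘ v.1, ⇑f ∘ v.2) = ⇑f ∘ SymplecticMatrix.darboux T hT v := by
  rw [SymplecticMatrix.darboux_apply, SymplecticMatrix.darboux_apply, Sum.comp_elim]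
  congr 1
  funext i
  rw [hTT']
  exact (RingHom.map_mulVec f T v.2 i).symm

/-- **Rationality by extension.** If `g' ∈ Sp(W', β_{T'})` over `K'` extends `g ∈ Sp(W, β_T)` over `K` along
`f : K →+* K'` on `K`-rational vectors — `g' (f ∘ x, f ∘ y) = f ∘∘ g (x, y)` — then `g'` IS the base change of `g`:
`g' = transportSp T' (mapHom f (untransportSp T g))` (both sides are `K'`-linear and agree on the standard basis,
which consists of `K`-rational vectors). [folklore] -/
theorem eq_transportSp_mapHom_untransportSp (g : symplecticGroup (polar (Matrix.toLinearMap₂' K T)))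
    (g' : symplecticGroup (polar (Matrix.toLinearMap₂' K' T')))
    (hext : ∀ v : (ι → K) × (ι → K),
      (g' : ((ι → K') × (ι → K')) ≃ₗ[K'] ((ι → K') × (ι → K'))) (⇑f ∘ v.1, ⇑f ∘ v.2) =
        (⇑f ∘ ((g : ((ι → K) × (ι → K)) ≃ₗ[K] ((ι → K) × (ι → K))) v).1,
          ⇑f ∘ ((g : ((ι → K) × (ι → K)) ≃ₗ[K] ((ι → K) × (ι → K))) v).2)) :
    g' = SymplecticMatrix.transportSp T' hT' (SymplecticMatrix.mapHom f (untransportSp T hT g)) := by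
  have key : (((SymplecticMatrix.darboux T' hT' : ((ι → K') × (ι → K')) ≃ₗ[K'] (ι ⊕ ι → K')) :
        ((ι → K') × (ι → K')) →ₗ[K'] (ι ⊕ ι → K')) ∘ₗ
        ((g' : ((ι → K') × (ι → K')) ≃ₗ[K'] ((ι → K') × (ι → K'))) :
          ((ι → K') × (ι → K')) →ₗ[K'] ((ι → K') × (ι → K'))) ∘ₗ
        (((SymplecticMatrix.darboux T' hT').symm : (ι ⊕ ι → K') ≃ₗ[K'] ((ι → K') × (ι → K'))) :
          (ι ⊕ ι → K') →ₗ[K'] ((ι → K') × (ι → K')))) =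
      Matrix.toLin' ((untransportMatrix T hT (g : ((ι → K) × (ι → K)) ≃ₗ[K] ((ι → K) × (ι → K)))).map f) := by
    refine (Pi.basisFun K' (ι ⊕ ι)).ext fun j => ?_
    have hej : (Pi.single j (1 : K') : ι ⊕ ι → K') =
        ⇑f ∘ SymplecticMatrix.darboux T hT ((SymplecticMatrix.darboux T hT).symm (Pi.single j 1)) := by
      rw [LinearEquiv.apply_symm_apply]
      funext i
      by_cases hij : i = j
      · subst hij; simp only [Pi.single_eq_same, Function.comp_apply, map_one]
      · simp only [Pi.single_eq_of_ne hij, Function.comp_apply, map_zero]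
    rw [Pi.basisFun_apply, Matrix.toLin'_apply, Matrix.mulVec_single_one, LinearMap.comp_apply,
      LinearMap.comp_apply, LinearEquiv.coe_coe, LinearEquiv.coe_coe, LinearEquiv.coe_coe, hej,
      ← darboux_baseChange T hT f T' hT' hTT', LinearEquiv.symm_apply_apply, hext,
      darboux_baseChange T hT f T' hT' hTT']
    funext i
    rw [Matrix.col_apply, Matrix.map_apply, untransportMatrix_apply, Function.comp_apply]
  apply Subtype.ext
  refine LinearEquiv.ext fun v => ?_
  rw [SymplecticMatrix.coe_transportSp_apply, SymplecticMatrix.coe_mapHom, coe_untransportSp, ← Matrix.toLin'_apply,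
    ← key]
  simp only [LinearMap.comp_apply, LinearEquiv.coe_coe, LinearEquiv.symm_apply_apply]

include hT in
/-- … hence such a `g'` is a `K`-RATIONAL POINT of `Sp(W', β_{T'})`: it lies in the range of
`(transportSp T' hT').comp (mapHom f)`. [folklore] -/
theorem mem_range_transportSp_mapHom (g : symplecticGroup (polar (Matrix.toLinearMap₂' K T)))
    (g' : symplecticGroup (polar (Matrix.toLinearMap₂' K' T')))
    (hext : ∀ v : (ι → K) × (ι → K),
      (g' : ((ι → K') × (ι → K')) ≃ₗ[K'] ((ι → K') × (ι → K'))) (⇑f ∘ v.1, ⇑f ∘ v.2) =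
        (⇑f ∘ ((g : ((ι → K) × (ι → K)) ≃ₗ[K] ((ι → K) × (ι → K))) v).1,
          ⇑f ∘ ((g : ((ι → K) × (ι → K)) ≃ₗ[K] ((ι → K) × (ι → K))) v).2)) :
    g' ∈ ((SymplecticMatrix.transportSp T' hT').comp (SymplecticMatrix.mapHom f)).range :=
  ⟨untransportSp T hT g, (eq_transportSp_mapHom_untransportSp T hT f T' hT' hTT' g g' hext).symm⟩

omit hTT' in
/-- `det (A ⊗ₖ B)` is a unit when `det A` and `det B` are. [folklore] -/
theorem isUnit_det_kronecker {κ : Type*} [Fintype κ] [DecidableEq κ] {A : Matrix ι ι K} {B : Matrix κ κ K}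
    (hA : IsUnit A.det) (hB : IsUnit B.det) : IsUnit (A ⊗ₖ B).det := by
  rw [Matrix.det_kronecker]
  exact (hA.pow _).mul (hB.pow _)

end Generic

end SpTransport

/-! ## 3. Number fields: `ι_𝔸(U(J)(F)) ⊆ Sp_F(W)` -/

section NumberField

variable (F E : Type) [Field F] [NumberField F] [Field E] [NumberField E] [Algebra F E]
variable (c : E ≃ₐ[F] E) (N : ℕ)

/-- **`ι_𝔸` extends `ι_F` on rational vectors**: for `γ ∈ U(J)(F)` and `x, y ∈ Fᴺ`,
`ι_𝔸(γ) (x, y) = ι_F(γ) (x, y)` read in `𝔸_F^{2N}` (both are the block matrix `[[γ₁, d γ₂], [γ₂, γ₁]]`).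
[cite: GelbartRogawski1991, §3.1 p. 455] -/
theorem adelicToSymplectic_toAdelic_apply_algebraMap [Algebra.IsQuadraticExtension F E] {δ : E} (hcδ : c δ = -δ)
    (hδ : δ ≠ 0) {d : F} (hd : δ * δ = algebraMap F E d) {T : Matrix (Fin N) (Fin N) F} (hT : T.IsSymm)
    {J : Matrix (Fin N) (Fin N) E} (hJ : J = T.map (algebraMap F E)) (γ : rational F E c N J)
    (v : (Fin N → F) × (Fin N → F)) :
    (adelicToSymplectic F E c N hcδ hδ hd hT hJ (toAdelic F E c N J γ)).1
        (⇑(algebraMap F (AdeleRing (𝓞 F) F)) ∘ v.1, ⇑(algebraMap F (AdeleRing (𝓞 F) F)) ∘ v.2) =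
      (⇑(algebraMap F (AdeleRing (𝓞 F) F)) ∘ ((rationalToSymplectic F E c N hcδ hδ hd hT hJ γ).1 v).1,
        ⇑(algebraMap F (AdeleRing (𝓞 F) F)) ∘ ((rationalToSymplectic F E c N hcδ hδ hd hT hJ γ).1 v).2) := by
  obtain ⟨a, b⟩ := v
  have hr : (rationalToSymplectic F E c N hcδ hδ hd hT hJ γ).1 (a, b) = _ :=
    (isQuadraticCoordinates_rat E c hcδ hδ hd).resAut_apply_mk (Fin N) (γ : GL (Fin N) E) a b
  rw [adelicToSymplectic_toAdelic_apply, hr]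
  refine Prod.ext (funext fun i => ?_) (funext fun i => ?_)
  · simp only [Pi.add_apply, Pi.smul_apply, smul_eq_mul, Function.comp_apply, map_add, map_mul, RingHom.map_mulVec]
  · simp only [Pi.add_apply, Function.comp_apply, map_add, RingHom.map_mulVec]

/-- **`ι_𝔸(γ)` is the base change of `ι_F(γ)`**: for `γ ∈ U(J)(F)` (`T.det ≠ 0`),
`adelicToSymplectic (toAdelic γ) = transportSp (T.map ι) (mapHom ι (untransportSp T (rationalToSymplectic γ)))`,
`ι = algebraMap F 𝔸_F`. [cite: GelbartRogawski1991, §3.1 p. 455] -/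
theorem adelicToSymplectic_toAdelic_eq_transportSp [Algebra.IsQuadraticExtension F E] {δ : E} (hcδ : c δ = -δ)
    (hδ : δ ≠ 0) {d : F} (hd : δ * δ = algebraMap F E d) {T : Matrix (Fin N) (Fin N) F} (hT : T.IsSymm)
    (hTd : IsUnit T.det) (hT' : IsUnit (T.map (algebraMap F (AdeleRing (𝓞 F) F))).det)
    {J : Matrix (Fin N) (Fin N) E} (hJ : J = T.map (algebraMap F E)) (γ : rational F E c N J) :
    adelicToSymplectic F E c N hcδ hδ hd hT hJ (toAdelic F E c N J γ) =
      SymplecticMatrix.transportSp (T.map (algebraMap F (AdeleRing (𝓞 F) F))) hT'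
        (SymplecticMatrix.mapHom (algebraMap F (AdeleRing (𝓞 F) F))
          (SpTransport.untransportSp T hTd (rationalToSymplectic F E c N hcδ hδ hd hT hJ γ))) :=
  SpTransport.eq_transportSp_mapHom_untransportSp T hTd (algebraMap F (AdeleRing (𝓞 F) F)) _ hT' rfl _ _
    (adelicToSymplectic_toAdelic_apply_algebraMap F E c N hcδ hδ hd hT hJ γ)

/-- **`toSp(G(F)) ⊆ Sp_F(W)`** (Gelbart–Rogawski's `s(G(F)) ⊂ i(Sp_F(W))`, group-theoretic half; the field
`toSp_mem_spRat` of a splitting datum): for every `γ ∈ U(J)(F)`, `ι_𝔸(γ)` lies in the range of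
`(transportSp (T.map ι) hT').comp (mapHom ι)` — the `F`-rational points of `Sp_𝔸(W)`.
[cite: GelbartRogawski1991, §3.1 p. 455] -/
theorem adelicToSymplectic_toAdelic_mem_range [Algebra.IsQuadraticExtension F E] {δ : E} (hcδ : c δ = -δ)
    (hδ : δ ≠ 0) {d : F} (hd : δ * δ = algebraMap F E d) {T : Matrix (Fin N) (Fin N) F} (hT : T.IsSymm)
    (hTd : IsUnit T.det) (hT' : IsUnit (T.map (algebraMap F (AdeleRing (𝓞 F) F))).det)
    {J : Matrix (Fin N) (Fin N) E} (hJ : J = T.map (algebraMap F E)) (γ : rational F E c N J) :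
    adelicToSymplectic F E c N hcδ hδ hd hT hJ (toAdelic F E c N J γ) ∈
      ((SymplecticMatrix.transportSp (T.map (algebraMap F (AdeleRing (𝓞 F) F))) hT').comp
        (SymplecticMatrix.mapHom (algebraMap F (AdeleRing (𝓞 F) F)))).range :=
  ⟨_, (adelicToSymplectic_toAdelic_eq_transportSp F E c N hcδ hδ hd hT hTd hT' hJ γ).symm⟩

/-- Range form: **`(ι_𝔸 ∘ toAdelic)(U(J)(F)) ≤ Sp_F(W)`**. [cite: GelbartRogawski1991, §3.1 p. 455] -/
theorem range_adelicToSymplectic_comp_toAdelic_le [Algebra.IsQuadraticExtension F E] {δ : E} (hcδ : c δ = -δ)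
    (hδ : δ ≠ 0) {d : F} (hd : δ * δ = algebraMap F E d) {T : Matrix (Fin N) (Fin N) F} (hT : T.IsSymm)
    (hTd : IsUnit T.det) (hT' : IsUnit (T.map (algebraMap F (AdeleRing (𝓞 F) F))).det)
    {J : Matrix (Fin N) (Fin N) E} (hJ : J = T.map (algebraMap F E)) :
    ((adelicToSymplectic F E c N hcδ hδ hd hT hJ).comp (toAdelic F E c N J)).range ≤
      ((SymplecticMatrix.transportSp (T.map (algebraMap F (AdeleRing (𝓞 F) F))) hT').comp
        (SymplecticMatrix.mapHom (algebraMap F (AdeleRing (𝓞 F) F)))).range := by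
  rintro _ ⟨γ, rfl⟩
  exact adelicToSymplectic_toAdelic_mem_range F E c N hcδ hδ hd hT hTd hT' hJ γ

/-- Image form: the image of the rational points `(toAdelic).range ≤ G(𝔸_F)` under `ι_𝔸` is contained in `Sp_F(W)`.
[cite: GelbartRogawski1991, §3.1 p. 455] -/
theorem map_adelicToSymplectic_range_toAdelic_le [Algebra.IsQuadraticExtension F E] {δ : E} (hcδ : c δ = -δ)
    (hδ : δ ≠ 0) {d : F} (hd : δ * δ = algebraMap F E d) {T : Matrix (Fin N) (Fin N) F} (hT : T.IsSymm)
    (hTd : IsUnit T.det) (hT' : IsUnit (T.map (algebraMap F (AdeleRing (𝓞 F) F))).det)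
    {J : Matrix (Fin N) (Fin N) E} (hJ : J = T.map (algebraMap F E)) :
    (toAdelic F E c N J).range.map (adelicToSymplectic F E c N hcδ hδ hd hT hJ) ≤
      ((SymplecticMatrix.transportSp (T.map (algebraMap F (AdeleRing (𝓞 F) F))) hT').comp
        (SymplecticMatrix.mapHom (algebraMap F (AdeleRing (𝓞 F) F)))).range := by
  rw [MonoidHom.map_range]
  exact range_adelicToSymplectic_comp_toAdelic_le F E c N hcδ hδ hd hT hTd hT' hJ

end NumberField

/-! ## 4. The dual pair: `toSp(G₁(F)) ⊆ Sp_F(𝕎)`, `𝕎 = Res(V ⊗ W)` -/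

section Pair

variable (F E : Type) [Field F] [NumberField F] [Field E] [NumberField E] [Algebra F E]
variable (c : E ≃ₐ[F] E) (N M : ℕ) (JV : Matrix (Fin N) (Fin N) E) (JW : Matrix (Fin M) (Fin M) E)

/-- **`G₁(F) = U(J_V ⊗ J_W)(F) →* Sp(F^{NM} × F^{NM}, alt (polar β_{T_V ⊗ T_W}))`**: the rational points of the big
unitary group of the dual pair in the rational symplectic group of `𝕎 = Res_{E/F}(V ⊗ W)`.
[cite: GelbartRogawski1991, §3.1 p. 454] -/
def rationalPairToSymplectic [Algebra.IsQuadraticExtension F E] {δ : E} (hcδ : c δ = -δ) (hδ : δ ≠ 0) {d : F}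
    (hd : δ * δ = algebraMap F E d) {TV : Matrix (Fin N) (Fin N) F} {TW : Matrix (Fin M) (Fin M) F}
    (hV : TV.IsSymm) (hW : TW.IsSymm) (hJV : JV = TV.map (algebraMap F E)) (hJW : JW = TW.map (algebraMap F E)) :
    rationalPair F E c N M JV JW →* symplecticGroup (polar (Matrix.toLinearMap₂' F (TV ⊗ₖ TW))) :=
  (isQuadraticCoordinates_rat E c hcδ hδ hd).pairToSymplectic hV hW (σ := (c : E →+* E)) (fun a => c.commutes a)
    hcδ hJV hJW

/-- `G₁(F) → Sp_F(𝕎)` is injective. [folklore] -/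
theorem rationalPairToSymplectic_injective [Algebra.IsQuadraticExtension F E] {δ : E} (hcδ : c δ = -δ)
    (hδ : δ ≠ 0) {d : F} (hd : δ * δ = algebraMap F E d) {TV : Matrix (Fin N) (Fin N) F}
    {TW : Matrix (Fin M) (Fin M) F} (hV : TV.IsSymm) (hW : TW.IsSymm) (hJV : JV = TV.map (algebraMap F E))
    (hJW : JW = TW.map (algebraMap F E)) :
    Function.Injective (rationalPairToSymplectic F E c N M JV JW hcδ hδ hd hV hW hJV hJW) :=
  (isQuadraticCoordinates_rat E c hcδ hδ hd).pairToSymplectic_injective hV hW _ hcδ hJV hJW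

/-- The block formula for `G₁(F)`: `toSp_F(γ) (a, b) = (γ₁ a + d γ₂ b, γ₂ a + γ₁ b)`, `γ = γ₁ + γ₂ δ`.
[folklore] -/
theorem rationalPairToSymplectic_apply_mk [Algebra.IsQuadraticExtension F E] {δ : E} (hcδ : c δ = -δ)
    (hδ : δ ≠ 0) {d : F} (hd : δ * δ = algebraMap F E d) {TV : Matrix (Fin N) (Fin N) F}
    {TW : Matrix (Fin M) (Fin M) F} (hV : TV.IsSymm) (hW : TW.IsSymm) (hJV : JV = TV.map (algebraMap F E))
    (hJW : JW = TW.map (algebraMap F E)) (γ : rationalPair F E c N M JV JW) (a b : Fin N × Fin M → F) :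
    (rationalPairToSymplectic F E c N M JV JW hcδ hδ hd hV hW hJV hJW γ).1 (a, b) =
      (((γ : GL (Fin N × Fin M) E) : Matrix (Fin N × Fin M) (Fin N × Fin M) E).map (QuadraticCoordinates.re
            (quadraticRatCoords E (not_mem_range_algebraMap_of_apply_eq_neg E c hcδ hδ)).toAddEquiv) *ᵥ a +
          d • (((γ : GL (Fin N × Fin M) E) : Matrix (Fin N × Fin M) (Fin N × Fin M) E).map (QuadraticCoordinates.im
            (quadraticRatCoords E (not_mem_range_algebraMap_of_apply_eq_neg E c hcδ hδ)).toAddEquiv) *ᵥ b),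
        ((γ : GL (Fin N × Fin M) E) : Matrix (Fin N × Fin M) (Fin N × Fin M) E).map (QuadraticCoordinates.im
            (quadraticRatCoords E (not_mem_range_algebraMap_of_apply_eq_neg E c hcδ hδ)).toAddEquiv) *ᵥ a +
          ((γ : GL (Fin N × Fin M) E) : Matrix (Fin N × Fin M) (Fin N × Fin M) E).map (QuadraticCoordinates.re
            (quadraticRatCoords E (not_mem_range_algebraMap_of_apply_eq_neg E c hcδ hδ)).toAddEquiv) *ᵥ b) :=
  (isQuadraticCoordinates_rat E c hcδ hδ hd).resAut_apply_mk (Fin N × Fin M) (γ : GL (Fin N × Fin M) E) a b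

/-- **`toSp` extends `toSp_F` on rational vectors** (dual-pair version of
`adelicToSymplectic_toAdelic_apply_algebraMap`). [cite: GelbartRogawski1991, §3.1 p. 455] -/
theorem adelicPairToSymplectic_rationalPairToAdelic_apply_algebraMap [Algebra.IsQuadraticExtension F E] {δ : E}
    (hcδ : c δ = -δ) (hδ : δ ≠ 0) {d : F} (hd : δ * δ = algebraMap F E d) {TV : Matrix (Fin N) (Fin N) F}
    {TW : Matrix (Fin M) (Fin M) F} (hV : TV.IsSymm) (hW : TW.IsSymm) (hJV : JV = TV.map (algebraMap F E))
    (hJW : JW = TW.map (algebraMap F E)) (γ : rationalPair F E c N M JV JW)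
    (v : (Fin N × Fin M → F) × (Fin N × Fin M → F)) :
    (adelicPairToSymplectic F E c N M hcδ hδ hd hV hW hJV hJW (rationalPairToAdelic F E c N M JV JW γ)).1
        (⇑(algebraMap F (AdeleRing (𝓞 F) F)) ∘ v.1, ⇑(algebraMap F (AdeleRing (𝓞 F) F)) ∘ v.2) =
      (⇑(algebraMap F (AdeleRing (𝓞 F) F)) ∘
          ((rationalPairToSymplectic F E c N M JV JW hcδ hδ hd hV hW hJV hJW γ).1 v).1,
        ⇑(algebraMap F (AdeleRing (𝓞 F) F)) ∘
          ((rationalPairToSymplectic F E c N M JV JW hcδ hδ hd hV hW hJV hJW γ).1 v).2) := by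
  obtain ⟨a, b⟩ := v
  rw [adelicPairToSymplectic_rationalPairToAdelic_apply, rationalPairToSymplectic_apply_mk]
  refine Prod.ext (funext fun i => ?_) (funext fun i => ?_)
  · simp only [Pi.add_apply, Pi.smul_apply, smul_eq_mul, Function.comp_apply, map_add, map_mul, RingHom.map_mulVec]
  · simp only [Pi.add_apply, Function.comp_apply, map_add, RingHom.map_mulVec]

/-- **`toSp(γ)` is the base change of `toSp_F(γ)`** for `γ ∈ G₁(F)` (`det T_V, det T_W ≠ 0`; Gram matrix of `𝕎`
is `T_V ⊗ₖ T_W`, read in `𝔸_F` as `T_V.map ι ⊗ₖ T_W.map ι`). [cite: GelbartRogawski1991, §3.1 p. 455] -/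
theorem adelicPairToSymplectic_rationalPairToAdelic_eq_transportSp [Algebra.IsQuadraticExtension F E] {δ : E}
    (hcδ : c δ = -δ) (hδ : δ ≠ 0) {d : F} (hd : δ * δ = algebraMap F E d) {TV : Matrix (Fin N) (Fin N) F}
    {TW : Matrix (Fin M) (Fin M) F} (hV : TV.IsSymm) (hW : TW.IsSymm) (hTd : IsUnit (TV ⊗ₖ TW).det)
    (hT' : IsUnit (TV.map (algebraMap F (AdeleRing (𝓞 F) F)) ⊗ₖ TW.map (algebraMap F (AdeleRing (𝓞 F) F))).det)
    (hJV : JV = TV.map (algebraMap F E)) (hJW : JW = TW.map (algebraMap F E)) (γ : rationalPair F E c N M JV JW) :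
    adelicPairToSymplectic F E c N M hcδ hδ hd hV hW hJV hJW (rationalPairToAdelic F E c N M JV JW γ) =
      SymplecticMatrix.transportSp
          (TV.map (algebraMap F (AdeleRing (𝓞 F) F)) ⊗ₖ TW.map (algebraMap F (AdeleRing (𝓞 F) F))) hT'
        (SymplecticMatrix.mapHom (algebraMap F (AdeleRing (𝓞 F) F))
          (SpTransport.untransportSp (TV ⊗ₖ TW) hTd
            (rationalPairToSymplectic F E c N M JV JW hcδ hδ hd hV hW hJV hJW γ))) :=
  SpTransport.eq_transportSp_mapHom_untransportSp (TV ⊗ₖ TW) hTd (algebraMap F (AdeleRing (𝓞 F) F)) _ hT'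
    (kronecker_map_map _ TV TW) _ _
    (adelicPairToSymplectic_rationalPairToAdelic_apply_algebraMap F E c N M JV JW hcδ hδ hd hV hW hJV hJW γ)

/-- **`toSp(G₁(F)) ⊆ Sp_F(𝕎)`** — the field `toSp_mem_spRat` of the dual-pair splitting datum: for every
`γ ∈ G₁(F)`, `toSp(γ)` lies in the range of `(transportSp (T_V.map ι ⊗ₖ T_W.map ι) hT').comp (mapHom ι)`.
[cite: GelbartRogawski1991, §3.1 p. 455] -/
theorem adelicPairToSymplectic_rationalPairToAdelic_mem_range [Algebra.IsQuadraticExtension F E] {δ : E}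
    (hcδ : c δ = -δ) (hδ : δ ≠ 0) {d : F} (hd : δ * δ = algebraMap F E d) {TV : Matrix (Fin N) (Fin N) F}
    {TW : Matrix (Fin M) (Fin M) F} (hV : TV.IsSymm) (hW : TW.IsSymm) (hTd : IsUnit (TV ⊗ₖ TW).det)
    (hT' : IsUnit (TV.map (algebraMap F (AdeleRing (𝓞 F) F)) ⊗ₖ TW.map (algebraMap F (AdeleRing (𝓞 F) F))).det)
    (hJV : JV = TV.map (algebraMap F E)) (hJW : JW = TW.map (algebraMap F E)) (γ : rationalPair F E c N M JV JW) :
    adelicPairToSymplectic F E c N M hcδ hδ hd hV hW hJV hJW (rationalPairToAdelic F E c N M JV JW γ) ∈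
      ((SymplecticMatrix.transportSp
          (TV.map (algebraMap F (AdeleRing (𝓞 F) F)) ⊗ₖ TW.map (algebraMap F (AdeleRing (𝓞 F) F))) hT').comp
        (SymplecticMatrix.mapHom (algebraMap F (AdeleRing (𝓞 F) F)))).range :=
  ⟨_, (adelicPairToSymplectic_rationalPairToAdelic_eq_transportSp F E c N M JV JW hcδ hδ hd hV hW hTd hT' hJV hJW
    γ).symm⟩

/-- Range form: **`(toSp ∘ rationalPairToAdelic)(G₁(F)) ≤ Sp_F(𝕎)`**. [cite: GelbartRogawski1991, §3.1 p. 455] -/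
theorem range_adelicPairToSymplectic_comp_rationalPairToAdelic_le [Algebra.IsQuadraticExtension F E] {δ : E}
    (hcδ : c δ = -δ) (hδ : δ ≠ 0) {d : F} (hd : δ * δ = algebraMap F E d) {TV : Matrix (Fin N) (Fin N) F}
    {TW : Matrix (Fin M) (Fin M) F} (hV : TV.IsSymm) (hW : TW.IsSymm) (hTd : IsUnit (TV ⊗ₖ TW).det)
    (hT' : IsUnit (TV.map (algebraMap F (AdeleRing (𝓞 F) F)) ⊗ₖ TW.map (algebraMap F (AdeleRing (𝓞 F) F))).det)
    (hJV : JV = TV.map (algebraMap F E)) (hJW : JW = TW.map (algebraMap F E)) :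
    ((adelicPairToSymplectic F E c N M hcδ hδ hd hV hW hJV hJW).comp (rationalPairToAdelic F E c N M JV JW)).range ≤
      ((SymplecticMatrix.transportSp
          (TV.map (algebraMap F (AdeleRing (𝓞 F) F)) ⊗ₖ TW.map (algebraMap F (AdeleRing (𝓞 F) F))) hT').comp
        (SymplecticMatrix.mapHom (algebraMap F (AdeleRing (𝓞 F) F)))).range := by
  rintro _ ⟨γ, rfl⟩
  exact adelicPairToSymplectic_rationalPairToAdelic_mem_range F E c N M JV JW hcδ hδ hd hV hW hTd hT' hJV hJW γ

/-- The images of `U(J_V)(F)` (through `adelicInl ∘ toAdelic`) land in `Sp_F(𝕎)` too. [folklore] -/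
theorem adelicPairToSymplectic_adelicInl_toAdelic_mem_range [Algebra.IsQuadraticExtension F E] {δ : E}
    (hcδ : c δ = -δ) (hδ : δ ≠ 0) {d : F} (hd : δ * δ = algebraMap F E d) {TV : Matrix (Fin N) (Fin N) F}
    {TW : Matrix (Fin M) (Fin M) F} (hV : TV.IsSymm) (hW : TW.IsSymm) (hTd : IsUnit (TV ⊗ₖ TW).det)
    (hT' : IsUnit (TV.map (algebraMap F (AdeleRing (𝓞 F) F)) ⊗ₖ TW.map (algebraMap F (AdeleRing (𝓞 F) F))).det)
    (hJV : JV = TV.map (algebraMap F E)) (hJW : JW = TW.map (algebraMap F E)) (γ : rational F E c N JV) :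
    adelicPairToSymplectic F E c N M hcδ hδ hd hV hW hJV hJW (adelicInl F E c N M JV JW (toAdelic F E c N JV γ)) ∈
      ((SymplecticMatrix.transportSp
          (TV.map (algebraMap F (AdeleRing (𝓞 F) F)) ⊗ₖ TW.map (algebraMap F (AdeleRing (𝓞 F) F))) hT').comp
        (SymplecticMatrix.mapHom (algebraMap F (AdeleRing (𝓞 F) F)))).range := by
  rw [adelicInl_toAdelic]
  exact adelicPairToSymplectic_rationalPairToAdelic_mem_range F E c N M JV JW hcδ hδ hd hV hW hTd hT' hJV hJW _

/-- The images of `U(J_W)(F)` (through `adelicInr ∘ toAdelic`) land in `Sp_F(𝕎)` too. [folklore] -/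
theorem adelicPairToSymplectic_adelicInr_toAdelic_mem_range [Algebra.IsQuadraticExtension F E] {δ : E}
    (hcδ : c δ = -δ) (hδ : δ ≠ 0) {d : F} (hd : δ * δ = algebraMap F E d) {TV : Matrix (Fin N) (Fin N) F}
    {TW : Matrix (Fin M) (Fin M) F} (hV : TV.IsSymm) (hW : TW.IsSymm) (hTd : IsUnit (TV ⊗ₖ TW).det)
    (hT' : IsUnit (TV.map (algebraMap F (AdeleRing (𝓞 F) F)) ⊗ₖ TW.map (algebraMap F (AdeleRing (𝓞 F) F))).det)
    (hJV : JV = TV.map (algebraMap F E)) (hJW : JW = TW.map (algebraMap F E)) (γ : rational F E c M JW) :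
    adelicPairToSymplectic F E c N M hcδ hδ hd hV hW hJV hJW (adelicInr F E c N M JV JW (toAdelic F E c M JW γ)) ∈
      ((SymplecticMatrix.transportSp
          (TV.map (algebraMap F (AdeleRing (𝓞 F) F)) ⊗ₖ TW.map (algebraMap F (AdeleRing (𝓞 F) F))) hT').comp
        (SymplecticMatrix.mapHom (algebraMap F (AdeleRing (𝓞 F) F)))).range := by
  rw [adelicInr_toAdelic]
  exact adelicPairToSymplectic_rationalPairToAdelic_mem_range F E c N M JV JW hcδ hδ hd hV hW hTd hT' hJV hJW _

end Pair

end UnitaryGroup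

end Literature.NumberTheory.Automorphic

end
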